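import Summits.CriticalPhenomena.PercolationContinuityZ3.Theorems.PercNearOneGluingNoHeavyLowerTailSunflowerMultiPetalBottomSpectator
import HarnessLib
import HarnessLib.Audit

/-!
# `NoHeavyLowerTail` (crux stmt-CriticalPhenomena-4575), abstract sunflower cubic, `k` petals: TERMWISE one-point monotonicity of the
# bottom-spectator functional `Q`, and ★ₖ / "Lemma B" under a mixed elimination order (inert · pendant · non-bottom singleton · petal-completing)

Support file (seat `prim-l12-p2` gen 36; `--supports stmt-CriticalPhenomena-4575`; second half of `…SunflowerMultiPetalBottomSpectator`
(`qK`, `QKW`, `qcIneqK`, `usIneqK`, `QKW_le_ZKW`, `QKW_univ_eq_spec`); uses `nested_insert_split` (…RestrictionSeriesPair),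
`nested_congr_of_subset` (…MultiPetalPendant, p377883)).  No `sorry`; nothing is asserted about the crux.
Memo: run/shared/lean/prim/prim-l12/prim-l12-p2/FINDING-g36-BOTTOM-SPECTATOR.md.

* `MSunflower.QKW_le_QKW_insert_of_completing` — `QKW W ≤ QKW (insert e W)` when every `X ⊆ W` has `lab X = 0 ∨ lab (insert e X) = ⊤`
  (PETAL-COMPLETING coordinate relative to the window; termwise, `qcIneqK`).
* `MSunflower.QKW_le_QKW_insert_of_lab_singleton_ne_zero` — `QKW W ≤ QKW (insert e W)` when `lab {e} ≠ 0` (termwise, `usIneqK`).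
* `MSunflower.QKW_insert_eq_three_mul_of_inert`, `MSunflower.QKW_insert_ge_of_pendant` — inert identity and PENDANT inequality
  `2·QKW W + QKW (W ∖ u) ≤ QKW (insert e W)` for `e` acting through `u` with `lab {e,u} ≠ 0` (identity + `usIneqK` with the offset `{e,u}`).
* `MSunflower.QKW_nonneg_of_mixedOrder`, `NtriK_le_of_mixedOrder`, `ZK_nonneg_of_mixedOrder` — if every nonempty sub-cube has a coordinate of
  one of the four kinds then `0 ≤ QKW W` for all `W`, LEMMA B `NtriK ≤ 3·SwK [bottom]`, and ★ₖ `0 ≤ ZK`.  For the coloured clutter of a graph: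
  every induced subgraph has an isolated vertex, a leaf, a half-edge vertex, or a vertex whose non-neighbours are independent (forests,
  split / threshold / co-chordal / complete multipartite graphs, such graphs with pendant trees attached, …).  ★ₖ at a petal-completing TOP
  coordinate alone was p340984 (`ZK_nonneg_of_petalCompleting`); the sub-cube induction and the Lemma-B strengthening are new.
-/

namespace Summit.CriticalPhenomena.PercolationContinuityZ3.Theorems.SunflowerPartition

open Finset

variable {α : Type*} [DecidableEq α]

namespace MSunflower

variable {k : ℕ} (F : MSunflower k α)

/-! ## Termwise one-point monotonicity of `QKW` -/

/-- Three-term lower bound at a PETAL-COMPLETING upper section: if `lab X = 0 ∨ lab (u X) = ⊤` for all `X ⊆ W`, then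
`QKW W ≤ Σ (qK with u applied to the first block) + (second) + (third)`. [this work] -/
theorem QKW_le_three_of_completing (W : Finset α) (u : Finset α → Finset α)
    (hpc : ∀ X : Finset α, X ⊆ W → F.lab X = 0 ∨ F.lab (u X) = Fin.last (k + 1)) :
    F.QKW W ≤ nested W (fun X S T => qK k (F.lab (u X)) (F.lab S) (F.lab T))
      + nested W (fun X S T => qK k (F.lab X) (F.lab (u S)) (F.lab T))
      + nested W (fun X S T => qK k (F.lab X) (F.lab S) (F.lab (u T))) := by
  unfold QKW nested
  rw [← sum_add_distrib, ← sum_add_distrib]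
  refine sum_le_sum fun X hX => ?_
  rw [← sum_add_distrib, ← sum_add_distrib]
  refine sum_le_sum fun S hS => ?_
  have hXW : X ⊆ W := mem_powerset.1 hX
  have hSW : S ⊆ W := (mem_powerset.1 hS).trans sdiff_subset
  have hTW : (W \ X) \ S ⊆ W := sdiff_subset.trans sdiff_subset
  exact qcIneqK _ _ _ _ _ _ (hpc X hXW) (hpc S hSW) (hpc _ hTW)

/-- Three-term lower bound at a NON-BOTTOM upper section: if `lab X ≤ lab (u X) ∈ {p, ⊤}` for all `X ⊆ W` and one label `p ≠ 0`, then
`QKW W ≤ Σ (qK with u applied to the first block) + (second) + (third)`. [this work] -/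
theorem QKW_le_three_of_upper (W : Finset α) (u : Finset α → Finset α) (p : Fin (k + 2)) (hp : p ≠ 0)
    (hmono : ∀ X : Finset α, X ⊆ W → F.lab X = F.lab (u X) ∨ F.lab X = 0 ∨ F.lab (u X) = Fin.last (k + 1))
    (hup : ∀ X : Finset α, X ⊆ W → F.lab (u X) = p ∨ F.lab (u X) = Fin.last (k + 1)) :
    F.QKW W ≤ nested W (fun X S T => qK k (F.lab (u X)) (F.lab S) (F.lab T))
      + nested W (fun X S T => qK k (F.lab X) (F.lab (u S)) (F.lab T))
      + nested W (fun X S T => qK k (F.lab X) (F.lab S) (F.lab (u T))) := by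
  unfold QKW nested
  rw [← sum_add_distrib, ← sum_add_distrib]
  refine sum_le_sum fun X hX => ?_
  rw [← sum_add_distrib, ← sum_add_distrib]
  refine sum_le_sum fun S hS => ?_
  have hXW : X ⊆ W := mem_powerset.1 hX
  have hSW : S ⊆ W := (mem_powerset.1 hS).trans sdiff_subset
  have hTW : (W \ X) \ S ⊆ W := sdiff_subset.trans sdiff_subset
  exact usIneqK p _ _ _ _ _ _ hp (hmono X hXW) (hmono S hSW) (hmono _ hTW) (hup X hXW) (hup S hSW) (hup _ hTW)

/-- The label of a superset of a non-bottom set `D` is `lab D` or the top. [this work] -/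
theorem lab_eq_or_top_of_subset {D Y : Finset α} (hD : F.lab D ≠ 0) (hDY : D ⊆ Y) :
    F.lab Y = F.lab D ∨ F.lab Y = Fin.last (k + 1) := by
  rcases F.lab_mono hDY with h | h | h
  · exact Or.inl h.symm
  · exact absurd h hD
  · exact Or.inr h

/-- **(MQₖ) AT A PETAL-COMPLETING COORDINATE** (termwise): for `e ∉ W`, if every `X ⊆ W` has `lab X = 0 ∨ lab (insert e X) = ⊤`
(every petal or kernel set of the window is completed into the kernel by `e`), then `QKW W ≤ QKW (insert e W)`. [this work] -/
theorem QKW_le_QKW_insert_of_completing (W : Finset α) (e : α) (he : e ∉ W)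
    (hpc : ∀ X : Finset α, X ⊆ W → F.lab X = 0 ∨ F.lab (insert e X) = Fin.last (k + 1)) :
    F.QKW W ≤ F.QKW (insert e W) := by
  have h := F.QKW_le_three_of_completing W (insert e) hpc
  unfold QKW at h ⊢
  rw [nested_insert_split W e he]
  exact h

/-- **(MQₖ) AT A COORDINATE WHOSE SINGLETON IS NOT A BOTTOM SET** (termwise): for `e ∉ W` with `lab {e} ≠ 0`,
`QKW W ≤ QKW (insert e W)`. [this work] -/
theorem QKW_le_QKW_insert_of_lab_singleton_ne_zero (W : Finset α) (e : α) (he : e ∉ W) (hne : F.lab {e} ≠ 0) :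
    F.QKW W ≤ F.QKW (insert e W) := by
  have h := F.QKW_le_three_of_upper W (insert e) (F.lab {e}) hne
    (fun X _ => F.lab_mono (subset_insert e X))
    (fun X _ => F.lab_eq_or_top_of_subset hne (by
      intro x hx
      rw [mem_singleton] at hx
      rw [hx]
      exact mem_insert_self e X))
  unfold QKW at h ⊢
  rw [nested_insert_split W e he]
  exact h

/-! ## Inert and pendant coordinates -/

/-- **PENDANT IDENTITY for `Q`**: if `e ∉ W` acts through `u` on `W` (`lab (insert e X) = lab X` for `X ⊆ W` with `u ∉ X`), then
`QKW (insert e W) = 2·QKW W + Σ_{(X,S,T) ⊢ W} qK (lab (insert e X)) (lab (insert e S)) (lab (insert e T))`. [this work] -/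
theorem QKW_insert_eq_of_actsThrough (W : Finset α) (e u : α) (he : e ∉ W)
    (hact : ∀ X : Finset α, X ⊆ W → u ∉ X → F.lab (insert e X) = F.lab X) :
    F.QKW (insert e W)
      = 2 * F.QKW W + nested W (fun X S T => qK k (F.lab (insert e X)) (F.lab (insert e S)) (F.lab (insert e T))) := by
  have key : ∀ X ∈ W.powerset, ∀ S ∈ (W \ X).powerset,
      qK k (F.lab (insert e X)) (F.lab S) (F.lab ((W \ X) \ S))
        + qK k (F.lab X) (F.lab (insert e S)) (F.lab ((W \ X) \ S))
        + qK k (F.lab X) (F.lab S) (F.lab (insert e ((W \ X) \ S)))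
      = 2 * qK k (F.lab X) (F.lab S) (F.lab ((W \ X) \ S))
        + qK k (F.lab (insert e X)) (F.lab (insert e S)) (F.lab (insert e ((W \ X) \ S))) := by
    intro X hX S hS
    have hXW : X ⊆ W := mem_powerset.1 hX
    have hS' : S ⊆ W \ X := mem_powerset.1 hS
    have hSW : S ⊆ W := hS'.trans sdiff_subset
    have hTW : (W \ X) \ S ⊆ W := sdiff_subset.trans sdiff_subset
    by_cases huX : u ∈ X
    · have huS : u ∉ S := fun h => (mem_sdiff.1 (hS' h)).2 huX
      have huT : u ∉ (W \ X) \ S := fun h => (mem_sdiff.1 (mem_sdiff.1 h).1).2 huX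
      rw [hact S hSW huS, hact _ hTW huT]
      ring
    · rw [hact X hXW huX]
      by_cases huS : u ∈ S
      · have huT : u ∉ (W \ X) \ S := fun h => (mem_sdiff.1 h).2 huS
        rw [hact _ hTW huT]
        ring
      · rw [hact S hSW huS]
        ring
  unfold QKW
  rw [nested_insert_split W e he]
  unfold nested
  rw [← sum_add_distrib, ← sum_add_distrib, mul_sum, ← sum_add_distrib]
  refine sum_congr rfl fun X hX => ?_
  rw [← sum_add_distrib, ← sum_add_distrib, mul_sum, ← sum_add_distrib]
  refine sum_congr rfl fun S hS => ?_
  exact key X hX S hS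

/-- **INERT COORDINATE for `Q`**: if `e ∉ W` changes no label on `W`, then `QKW (insert e W) = 3·QKW W`. [this work] -/
theorem QKW_insert_eq_three_mul_of_inert (W : Finset α) (e : α) (he : e ∉ W)
    (hinert : ∀ X : Finset α, X ⊆ W → F.lab (insert e X) = F.lab X) :
    F.QKW (insert e W) = 3 * F.QKW W := by
  rw [F.QKW_insert_eq_of_actsThrough W e e he (fun X hX _ => hinert X hX)]
  have h : nested W (fun X S T => qK k (F.lab (insert e X)) (F.lab (insert e S)) (F.lab (insert e T))) = F.QKW W := by
    unfold QKW
    exact nested_congr_of_subset W _ _ fun X S T hX hS hT => by rw [hinert X hX, hinert S hS, hinert T hT]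
  rw [h]
  ring

/-- **PENDANT INEQUALITY for `Q`**: if `e ∉ W` acts through `u ∈ W` on `W` and `lab {e,u} ≠ 0`, then
`2·QKW W + QKW (W ∖ u) ≤ QKW (insert e W)` (pendant identity + the termwise non-bottom-offset inequality with offset `{e,u}`). [this work] -/
theorem QKW_insert_ge_of_pendant (W : Finset α) (e u : α) (he : e ∉ W) (hu : u ∈ W)
    (hact : ∀ X : Finset α, X ⊆ W → u ∉ X → F.lab (insert e X) = F.lab X) (hne : F.lab (insert e {u}) ≠ 0) :
    2 * F.QKW W + F.QKW (W.erase u) ≤ F.QKW (insert e W) := by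
  rw [F.QKW_insert_eq_of_actsThrough W e u he hact]
  set W' := W.erase u with hW'
  have huW' : u ∉ W' := notMem_erase u W
  have hWu : insert u W' = W := insert_erase hu
  have hW'W : W' ⊆ W := erase_subset u W
  -- split the upper nested sum at `u` and remove `e` from the blocks not containing `u`
  have hsplit := nested_insert_split W' u huW' (fun X S T => qK k (F.lab (insert e X)) (F.lab (insert e S)) (F.lab (insert e T)))
  rw [hWu] at hsplit
  set v : Finset α → Finset α := fun X => insert e (insert u X) with hv
  have hA : nested W' (fun X S T => qK k (F.lab (insert e (insert u X))) (F.lab (insert e S)) (F.lab (insert e T)))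
      = nested W' (fun X S T => qK k (F.lab (v X)) (F.lab S) (F.lab T)) :=
    nested_congr_of_subset W' _ _ fun X S T _ hS hT => by
      rw [hact S (hS.trans hW'W) (fun h => huW' (hS h)), hact T (hT.trans hW'W) (fun h => huW' (hT h))]
  have hB : nested W' (fun X S T => qK k (F.lab (insert e X)) (F.lab (insert e (insert u S))) (F.lab (insert e T)))
      = nested W' (fun X S T => qK k (F.lab X) (F.lab (v S)) (F.lab T)) :=
    nested_congr_of_subset W' _ _ fun X S T hX _ hT => by
      rw [hact X (hX.trans hW'W) (fun h => huW' (hX h)), hact T (hT.trans hW'W) (fun h => huW' (hT h))]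
  have hC : nested W' (fun X S T => qK k (F.lab (insert e X)) (F.lab (insert e S)) (F.lab (insert e (insert u T))))
      = nested W' (fun X S T => qK k (F.lab X) (F.lab S) (F.lab (v T))) :=
    nested_congr_of_subset W' _ _ fun X S T hX hS _ => by
      rw [hact X (hX.trans hW'W) (fun h => huW' (hX h)), hact S (hS.trans hW'W) (fun h => huW' (hS h))]
  rw [hA, hB, hC] at hsplit
  -- the termwise inequality with the non-bottom offset `{e,u}`
  have hsub : ∀ X : Finset α, insert e ({u} : Finset α) ⊆ v X := by
    intro X x hx
    rw [mem_insert, mem_singleton] at hx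
    rcases hx with h | h
    · rw [h]; exact mem_insert_self e _
    · rw [h]; exact mem_insert_of_mem (mem_insert_self u X)
  have hXv : ∀ X : Finset α, X ⊆ v X := fun X => (subset_insert u X).trans (subset_insert e _)
  have h3 := F.QKW_le_three_of_upper W' v (F.lab (insert e {u})) hne (fun X _ => F.lab_mono (hXv X))
    (fun X _ => F.lab_eq_or_top_of_subset hne (hsub X))
  rw [← hsplit] at h3
  linarith

/-! ## ★ₖ and Lemma B under a mixed elimination order -/

/-- **`Q ≥ 0` UNDER A MIXED ELIMINATION ORDER** (this work).  Suppose every nonempty sub-cube `W` has a coordinate `e ∈ W` which,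
relative to `W ∖ e`, is INERT, or PENDANT (acts through some `u ∈ W ∖ e` with `lab {e,u} ≠ 0`), or has a NON-BOTTOM SINGLETON, or is
PETAL-COMPLETING (`lab X = 0 ∨ lab (insert e X) = ⊤` for all `X ⊆ W ∖ e`).  Then `0 ≤ QKW W` for every sub-cube `W`.  (Coloured clutter
of a graph: every induced subgraph has an isolated vertex, a leaf, a half-edge vertex, or a vertex whose non-neighbours are independent.)
[this work] -/
theorem QKW_nonneg_of_mixedOrder
    (hp : ∀ W : Finset α, W.Nonempty → ∃ e ∈ W,
      (∀ X : Finset α, X ⊆ W.erase e → F.lab (insert e X) = F.lab X)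
      ∨ (∃ u ∈ W.erase e, (∀ X : Finset α, X ⊆ W.erase e → u ∉ X → F.lab (insert e X) = F.lab X) ∧ F.lab (insert e {u}) ≠ 0)
      ∨ F.lab {e} ≠ 0
      ∨ (∀ X : Finset α, X ⊆ W.erase e → F.lab X = 0 ∨ F.lab (insert e X) = Fin.last (k + 1))) :
    ∀ W : Finset α, 0 ≤ F.QKW W := by
  intro W
  induction W using Finset.strongInduction with
  | H W ih =>
    by_cases hW : W.Nonempty
    · obtain ⟨e, heW, hcases⟩ := hp W hW
      have hWe : insert e (W.erase e) = W := insert_erase heW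
      have he : e ∉ W.erase e := notMem_erase e W
      have hlt : W.erase e ⊂ W := erase_ssubset heW
      have ih1 : 0 ≤ F.QKW (W.erase e) := ih _ hlt
      rcases hcases with hinert | ⟨u, huW, hact, hne⟩ | hsing | hpc
      · have h3 := F.QKW_insert_eq_three_mul_of_inert (W.erase e) e he hinert
        rw [hWe] at h3
        rw [h3]
        linarith
      · have h2 := F.QKW_insert_ge_of_pendant (W.erase e) e u he huW hact hne
        rw [hWe] at h2
        have hlt' : (W.erase e).erase u ⊂ W := lt_of_le_of_lt (erase_subset u (W.erase e)) hlt
        have ih2 : 0 ≤ F.QKW ((W.erase e).erase u) := ih _ hlt'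
        linarith
      · have h1 := F.QKW_le_QKW_insert_of_lab_singleton_ne_zero (W.erase e) e he hsing
        rw [hWe] at h1
        linarith
      · have h1 := F.QKW_le_QKW_insert_of_completing (W.erase e) e he hpc
        rw [hWe] at h1
        linarith
    · rw [not_nonempty_iff_eq_empty.1 hW, F.QKW_empty]

variable [Fintype α]

/-- **LEMMA B UNDER A MIXED ELIMINATION ORDER** (this work): under the hypothesis of `QKW_nonneg_of_mixedOrder`,
`NtriK ≤ 3·SwK [bottom]` — the rainbows are paid by the bottom spectators' Gladkov slack alone. [this work] -/
theorem NtriK_le_of_mixedOrder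
    (hp : ∀ W : Finset α, W.Nonempty → ∃ e ∈ W,
      (∀ X : Finset α, X ⊆ W.erase e → F.lab (insert e X) = F.lab X)
      ∨ (∃ u ∈ W.erase e, (∀ X : Finset α, X ⊆ W.erase e → u ∉ X → F.lab (insert e X) = F.lab X) ∧ F.lab (insert e {u}) ≠ 0)
      ∨ F.lab {e} ≠ 0
      ∨ (∀ X : Finset α, X ⊆ W.erase e → F.lab X = 0 ∨ F.lab (insert e X) = Fin.last (k + 1))) :
    F.NtriK ≤ 3 * F.SwK (botK k) := by
  have h := F.QKW_nonneg_of_mixedOrder hp univ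
  rw [F.QKW_univ_eq_spec] at h
  linarith

/-- **★ₖ UNDER A MIXED ELIMINATION ORDER** (this work): under the hypothesis of `QKW_nonneg_of_mixedOrder`, `0 ≤ ZK`. [this work] -/
theorem ZK_nonneg_of_mixedOrder
    (hp : ∀ W : Finset α, W.Nonempty → ∃ e ∈ W,
      (∀ X : Finset α, X ⊆ W.erase e → F.lab (insert e X) = F.lab X)
      ∨ (∃ u ∈ W.erase e, (∀ X : Finset α, X ⊆ W.erase e → u ∉ X → F.lab (insert e X) = F.lab X) ∧ F.lab (insert e {u}) ≠ 0)
      ∨ F.lab {e} ≠ 0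
      ∨ (∀ X : Finset α, X ⊆ W.erase e → F.lab X = 0 ∨ F.lab (insert e X) = Fin.last (k + 1))) :
    0 ≤ F.ZK :=
  F.ZK_nonneg_of_lemmaB (F.NtriK_le_of_mixedOrder hp)

end MSunflower

end Summit.CriticalPhenomena.PercolationContinuityZ3.Theorems.SunflowerPartition
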